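import Summits.RiemannHypothesis.RiemannHypothesis.Theorems.WeilFormatCCinfArchMonomials
import Summits.RiemannHypothesis.RiemannHypothesis.Theorems.WeilFormatCPolyWindowConstantsBox
import HarnessLib

/-!
# Format C, design C∞ (E2, data side): kernel boxes for the ARCH REMAINDER constants `remS(m₀)`, `remC(m₀)`

Route context: Fourier–Galerkin / Schur-complement certificates of Weil positivity on a window ("format C", C∞ door;
cell memo `run/shared/lean/pub/rh-explicit/rh-explicit-weil-2/gen15/E2-PLAN-v2.md` §5; supporting stmt-RiemannHypothesis-0098;
seat rh-explicit-weil-2).  The printed monomial lists of the C∞ door carry ONE remainder constant per object, built from the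
two arch remainders of `abs_archSin/Cos_sub_monomials_le` (`WeilFormatCCinfArchMonomials`) at the mode `m₀ = B₃`:
`remS(m₀) = 𝔅(ν,K,u)/2 + D_{2R}/(πm₀/a)^{2R+1}`, `remC(m₀) = 𝔅(ν,K,u)/2 + D_{2R+1}/(πm₀/a)^{2R+2}` with
`u = 1/(4(πm₀/a/2))` and the bracket
`𝔅 = (4π²/3)(2ν+1)!/(2π)^{2ν+1}(4u)^{2ν} + u^{K+1}/((K+1)(1−u)) + 2u^{K+1} + Σ_{k∈[1,ν]} |B_{2k}/(2k)| 2^{K+1+4k} u^{K+1}`.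
The rung generator (E2) needs certified UPPER bounds of these numbers (the door's `ρrowe`/`ρimge` may be any rational
dominating the printed remainder).  Here (interval plumbing only): `CinfCoeff.remBracketBox`, `remSBox`, `remCBox` and their
`mem_` lemmas, with the INPUTS `P ∋ π` (e.g. `MI.pi`), a Bernoulli list `bt` with `bt[k] = B_{2(k+1)}` for `k < ν`
(`MC.bernoulliTable` / `bernoulliTable42`), and a box `D ∋ D_p(a)` of the node moment (`CinfCoeff.nodeMomentBox`,
`WeilFormatCCinfNodeMoments`).  PRECISION: the bracket multiplies the tiny power `u^{K+1}` (absolute width ≈ K ulps) by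
the large Bernoulli weight (≈ 1e28 at ν = 13, K = 26), so the scale must absorb it: at `a = 1`, `m₀ = 256`,
`(ν,K,R) = (13,26,12)` the boxes reproduce `remS = 10^{−56.6598}`, `remC = 10^{−58.1071}` to `±0.0003` in the exponent at
`S = 2^512` (`#guard`-checked against an mpmath evaluation), while `S = 2^256` leaves the upper end at `≈ 1e-50` — use
`S ≥ 2^512` here and `MI.rescale` down to the table scale.  Fixed-point intervals `MI` at scale `S`; standard axioms; no RH claim.
-/

set_option autoImplicit false
-- `Summit.RiemannHypothesis.RiemannHypothesis.…` is the layout-mandated namespace (summit = problem name).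
set_option linter.dupNamespace false

open Finset
open scoped Real

namespace Summit.RiemannHypothesis.RiemannHypothesis.Theorems.WeilFormatC

open Literature.Analysis.SpecialFunctions
open Literature.Analysis.ValidatedNumerics Literature.Analysis.ValidatedNumerics.NumericsMP

namespace CinfCoeff

open WinConst (ratBox mem_ratBox mulRatBox mem_mulRatBox)

variable {S : ℕ}

/-- `x^n` by repeated outward multiplication. -/
def powB (S : ℕ) (X : MI) : ℕ → MI
  | 0 => MI.ofInt S 1
  | n + 1 => (powB S X n).mul S X

/-- `powB ∋ x^n`. -/
theorem mem_powB (hS : 0 < S) {x : ℝ} {X : MI} (hx : MI.mem S x X) : ∀ n : ℕ, MI.mem S (x ^ n) (powB S X n)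
  | 0 => by simpa [powB] using MI.mem_ofInt S 1
  | n + 1 => by rw [pow_succ, powB]; exact MI.mem_mul hS (mem_powB hS hx n) hx

/-- The Bernoulli weight `Σ_{k∈[1,ν]} |B_{2k}/(2k)|·2^{K+1+4k}` as an exact rational from a list `bt` with `bt[k−1] = B_{2k}`. -/
def bernWeightQ (bt : List ℚ) (K ν : ℕ) : ℚ :=
  ∑ k ∈ Finset.Icc 1 ν, |bt.getD (k - 1) 0 / (2 * k)| * 2 ^ (K + 1 + 4 * k)

/-- With a correct Bernoulli list the rational weight IS the real Bernoulli weight. -/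
theorem bernWeightQ_cast (bt : List ℚ) (K ν : ℕ) (hbt : ∀ k, k < ν → bt.getD k 0 = bernoulli (2 * (k + 1))) :
    ((bernWeightQ bt K ν : ℚ) : ℝ)
      = ∑ k ∈ Finset.Icc 1 ν, |(bernoulli (2 * k) : ℝ) / (2 * k)| * 2 ^ (K + 1 + 4 * k) := by
  rw [bernWeightQ, Rat.cast_sum]
  refine Finset.sum_congr rfl fun k hk ↦ ?_
  rw [Finset.mem_Icc] at hk
  have h := hbt (k - 1) (by omega)
  rw [show k - 1 + 1 = k by omega] at h
  rw [h]
  push_cast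
  ring

/-- `u = 1/(4(πm₀/a/2)) = (a/(2m₀))/π`. -/
def uBox (S : ℕ) (P : MI) (a : ℚ) (m₀ : ℕ) : Option MI := MI.divPos S (ratBox S (a / (2 * m₀))) P

/-- `uBox ∋ 1/(4(πm₀/a/2))`. -/
theorem mem_uBox (hS : 0 < S) {P : MI} (hP : MI.mem S Real.pi P) {a : ℚ} (ha : 0 < a) {m₀ : ℕ} (hm₀ : 0 < m₀)
    {U : MI} (hU : uBox S P a m₀ = some U) : MI.mem S (1 / (4 * (π * (m₀ : ℝ) / (a : ℝ) / 2))) U := by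
  have h := MI.mem_divPos hS hU (mem_ratBox S (a / (2 * m₀))) hP
  have ha' : (a : ℝ) ≠ 0 := by exact_mod_cast ha.ne'
  have hm' : (m₀ : ℝ) ≠ 0 := by exact_mod_cast hm₀.ne'
  have e : (1 / (4 * (π * (m₀ : ℝ) / (a : ℝ) / 2))) = (((a / (2 * m₀) : ℚ)) : ℝ) / Real.pi := by
    push_cast
    field_simp
    ring
  rw [e]; exact h

/-- **The bracket box** `𝔅(ν,K,u) ∋ remBracketBox` (inputs: `P ∋ π`, Bernoulli list `bt`). -/
def remBracketBox (S : ℕ) (P : MI) (a : ℚ) (m₀ ν K : ℕ) (bt : List ℚ) : Option MI :=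
  match uBox S P a m₀ with
  | none => none
  | some U =>
    match MI.divPos S (((MI.sqr S P).mul S (ratBox S (4 * ((2 * ν + 1).factorial : ℚ) / 3))).mul S
              (powB S (U.mulInt 4) (2 * ν))) (powB S (P.mulInt 2) (2 * ν + 1)),
          MI.divPos S (powB S U (K + 1)) ((MI.ofInt S 1).sub U) with
    | some T1, some T2 =>
      some (((T1.add (T2.divNat (K + 1))).add ((powB S U (K + 1)).mulInt 2)).add
        (mulRatBox (powB S U (K + 1)) (bernWeightQ bt K ν)))
    | _, _ => none

/-- `remBracketBox ∋ 𝔅(ν,K,u)` (the common bracket of `remS`, `remC`). -/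
theorem mem_remBracketBox (hS : 0 < S) {P : MI} (hP : MI.mem S Real.pi P) {a : ℚ} (ha : 0 < a) {m₀ : ℕ}
    (hm₀ : 0 < m₀) (ν K : ℕ) {bt : List ℚ} (hbt : ∀ k, k < ν → bt.getD k 0 = bernoulli (2 * (k + 1)))
    {B : MI} (hB : remBracketBox S P a m₀ ν K bt = some B) :
    MI.mem S
      (4 * Real.pi ^ 2 / 3 * ((2 * ν + 1).factorial : ℝ) / (2 * Real.pi) ^ (2 * ν + 1)
          * (4 * (1 / (4 * (π * m₀ / a / 2)))) ^ (2 * ν)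
        + (1 / (4 * (π * m₀ / a / 2))) ^ (K + 1) / ((K + 1) * (1 - 1 / (4 * (π * m₀ / a / 2))))
        + 2 * (1 / (4 * (π * m₀ / a / 2))) ^ (K + 1)
        + ∑ k ∈ Finset.Icc 1 ν, |(bernoulli (2 * k) : ℝ) / (2 * k)| * 2 ^ (K + 1 + 4 * k)
            * (1 / (4 * (π * m₀ / a / 2))) ^ (K + 1)) B := by
  unfold remBracketBox at hB
  split at hB
  · simp at hB
  · rename_i U hU
    have hu := mem_uBox hS hP ha hm₀ hU
    set u : ℝ := 1 / (4 * (π * (m₀ : ℝ) / (a : ℝ) / 2)) with hudef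
    split at hB
    · rename_i T1 T2 hT1 hT2
      simp only [Option.some.injEq] at hB
      subst hB
      -- T1 ∋ (π² · (4(2ν+1)!/3) · (4u)^{2ν}) / (2π)^{2ν+1}
      have h4u : MI.mem S (u * (4 : ℤ)) (U.mulInt 4) := MI.mem_mulInt hu 4
      have hnum : MI.mem S (Real.pi ^ 2 * ((4 * ((2 * ν + 1).factorial : ℚ) / 3 : ℚ) : ℝ) * (u * (4 : ℤ)) ^ (2 * ν))
          (((MI.sqr S P).mul S (ratBox S (4 * ((2 * ν + 1).factorial : ℚ) / 3))).mul S (powB S (U.mulInt 4) (2 * ν))) :=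
        MI.mem_mul hS (MI.mem_mul hS (MI.mem_sqr hS hP) (mem_ratBox S _)) (mem_powB hS h4u _)
      have hden : MI.mem S ((Real.pi * (2 : ℤ)) ^ (2 * ν + 1)) (powB S (P.mulInt 2) (2 * ν + 1)) :=
        mem_powB hS (MI.mem_mulInt hP 2) _
      have hT1m := MI.mem_divPos hS hT1 hnum hden
      -- T2 ∋ u^{K+1}/(1−u)
      have hUK := mem_powB hS hu (K + 1)
      have h1u : MI.mem S (1 - u) ((MI.ofInt S 1).sub U) := by
        have := MI.mem_sub (MI.mem_ofInt S 1) hu; simpa using this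
      have hT2m := MI.mem_divPos hS hT2 hUK h1u
      have hT2d := MI.mem_divNat hT2m (n := K + 1) (by omega)
      have hT3 : MI.mem S (u ^ (K + 1) * (2 : ℤ)) ((powB S U (K + 1)).mulInt 2) := MI.mem_mulInt hUK 2
      have hT4 := mem_mulRatBox hUK (bernWeightQ bt K ν)
      rw [bernWeightQ_cast bt K ν hbt] at hT4
      have hsum := MI.mem_add (MI.mem_add (MI.mem_add hT1m hT2d) hT3) hT4
      have e : (4 * Real.pi ^ 2 / 3 * ((2 * ν + 1).factorial : ℝ) / (2 * Real.pi) ^ (2 * ν + 1) * (4 * u) ^ (2 * ν)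
            + u ^ (K + 1) / ((K + 1) * (1 - u)) + 2 * u ^ (K + 1)
            + ∑ k ∈ Finset.Icc 1 ν, |(bernoulli (2 * k) : ℝ) / (2 * k)| * 2 ^ (K + 1 + 4 * k) * u ^ (K + 1))
          = (Real.pi ^ 2 * ((4 * ((2 * ν + 1).factorial : ℚ) / 3 : ℚ) : ℝ) * (u * (4 : ℤ)) ^ (2 * ν)
                / (Real.pi * (2 : ℤ)) ^ (2 * ν + 1)
              + u ^ (K + 1) / (1 - u) / ((K + 1 : ℕ) : ℝ) + u ^ (K + 1) * (2 : ℤ)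
              + u ^ (K + 1) * ∑ k ∈ Finset.Icc 1 ν, |(bernoulli (2 * k) : ℝ) / (2 * k)| * 2 ^ (K + 1 + 4 * k)) := by
        rw [Finset.mul_sum]
        have hs : ∑ k ∈ Finset.Icc 1 ν, |(bernoulli (2 * k) : ℝ) / (2 * k)| * 2 ^ (K + 1 + 4 * k) * u ^ (K + 1)
            = ∑ k ∈ Finset.Icc 1 ν, u ^ (K + 1) * (|(bernoulli (2 * k) : ℝ) / (2 * k)| * 2 ^ (K + 1 + 4 * k)) :=
          Finset.sum_congr rfl fun k _ ↦ by ring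
        rw [hs]; push_cast
        rw [div_div, mul_comm (1 - u) ((K : ℝ) + 1)]
        ring
      rw [e]; exact hsum
    · simp at hB

/-- `ω₀ = πm₀/a` box. -/
def omega0Box (P : MI) (a : ℚ) (m₀ : ℕ) : MI := mulRatBox P ((m₀ : ℚ) / a)

/-- `omega0Box ∋ πm₀/a`. -/
theorem mem_omega0Box {P : MI} (hP : MI.mem S Real.pi P) (a : ℚ) (m₀ : ℕ) :
    MI.mem S (π * (m₀ : ℝ) / (a : ℝ)) (omega0Box P a m₀) := by
  have h := mem_mulRatBox hP ((m₀ : ℚ) / a)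
  rw [omega0Box]; convert h using 2; push_cast; ring

/-- **`remSBox`**: `𝔅/2 + D_{2R}/(πm₀/a)^{2R+1}` from the bracket box and an input box `D ∋ D_{2R}(a)`. -/
def remSBox (S : ℕ) (P : MI) (a : ℚ) (m₀ ν K R : ℕ) (bt : List ℚ) (D : MI) : Option MI :=
  match remBracketBox S P a m₀ ν K bt, MI.divPos S D (powB S (omega0Box P a m₀) (2 * R + 1)) with
  | some B, some T => some ((B.divNat 2).add T)
  | _, _ => none

/-- **`remSBox ∋ remS(m₀)`**, the remainder constant of `abs_archSin_sub_monomials_le` /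
`abs_evenRow/oddRow_sub_monomials_le` at the mode `m₀` (`a > 0`, `m₀ ≥ 1`). -/
theorem mem_remSBox (hS : 0 < S) {P : MI} (hP : MI.mem S Real.pi P) {a : ℚ} (ha : 0 < a) {m₀ : ℕ}
    (hm₀ : 0 < m₀) (ν K R : ℕ) {bt : List ℚ} (hbt : ∀ k, k < ν → bt.getD k 0 = bernoulli (2 * (k + 1)))
    {D : MI} (hD : MI.mem S (∑' k : ℕ, Real.exp (-(2 * (a : ℝ) * digammaNode k)) * digammaNode k ^ (2 * R)) D)
    {X : MI} (hX : remSBox S P a m₀ ν K R bt D = some X) :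
    MI.mem S
      ((4 * Real.pi ^ 2 / 3 * ((2 * ν + 1).factorial : ℝ) / (2 * Real.pi) ^ (2 * ν + 1)
            * (4 * (1 / (4 * (π * m₀ / a / 2)))) ^ (2 * ν)
          + (1 / (4 * (π * m₀ / a / 2))) ^ (K + 1) / ((K + 1) * (1 - 1 / (4 * (π * m₀ / a / 2))))
          + 2 * (1 / (4 * (π * m₀ / a / 2))) ^ (K + 1)
          + ∑ k ∈ Finset.Icc 1 ν, |(bernoulli (2 * k) : ℝ) / (2 * k)| * 2 ^ (K + 1 + 4 * k)
              * (1 / (4 * (π * m₀ / a / 2))) ^ (K + 1)) / 2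
        + (∑' k : ℕ, Real.exp (-(2 * (a : ℝ) * digammaNode k)) * digammaNode k ^ (2 * R))
            / |π * m₀ / a| ^ (2 * R + 1)) X := by
  unfold remSBox at hX
  split at hX
  · rename_i B T hB hT
    simp only [Option.some.injEq] at hX
    subst hX
    have hBm := MI.mem_divNat (mem_remBracketBox hS hP ha hm₀ ν K hbt hB) (n := 2) (by norm_num)
    have hω := mem_powB hS (mem_omega0Box hP a m₀) (2 * R + 1)
    have hTm := MI.mem_divPos hS hT hD hω
    have hpos : 0 ≤ π * (m₀ : ℝ) / (a : ℝ) := by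
      have : (0 : ℝ) < a := by exact_mod_cast ha
      positivity
    rw [abs_of_nonneg hpos]
    convert MI.mem_add hBm hTm using 1
    push_cast; ring
  · simp at hX

/-- **`remCBox`**: `𝔅/2 + D_{2R+1}/(πm₀/a)^{2R+2}` (input box `D ∋ D_{2R+1}(a)`). -/
def remCBox (S : ℕ) (P : MI) (a : ℚ) (m₀ ν K R : ℕ) (bt : List ℚ) (D : MI) : Option MI :=
  match remBracketBox S P a m₀ ν K bt, MI.divPos S D (powB S (omega0Box P a m₀) (2 * R + 2)) with
  | some B, some T => some ((B.divNat 2).add T)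
  | _, _ => none

/-- **`remCBox ∋ remC(m₀)`**, the remainder constant of `abs_archCos_sub_monomials_le` at the mode `m₀`. -/
theorem mem_remCBox (hS : 0 < S) {P : MI} (hP : MI.mem S Real.pi P) {a : ℚ} (ha : 0 < a) {m₀ : ℕ}
    (hm₀ : 0 < m₀) (ν K R : ℕ) {bt : List ℚ} (hbt : ∀ k, k < ν → bt.getD k 0 = bernoulli (2 * (k + 1)))
    {D : MI} (hD : MI.mem S (∑' k : ℕ, Real.exp (-(2 * (a : ℝ) * digammaNode k)) * digammaNode k ^ (2 * R + 1)) D)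
    {X : MI} (hX : remCBox S P a m₀ ν K R bt D = some X) :
    MI.mem S
      ((4 * Real.pi ^ 2 / 3 * ((2 * ν + 1).factorial : ℝ) / (2 * Real.pi) ^ (2 * ν + 1)
            * (4 * (1 / (4 * (π * m₀ / a / 2)))) ^ (2 * ν)
          + (1 / (4 * (π * m₀ / a / 2))) ^ (K + 1) / ((K + 1) * (1 - 1 / (4 * (π * m₀ / a / 2))))
          + 2 * (1 / (4 * (π * m₀ / a / 2))) ^ (K + 1)
          + ∑ k ∈ Finset.Icc 1 ν, |(bernoulli (2 * k) : ℝ) / (2 * k)| * 2 ^ (K + 1 + 4 * k)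
              * (1 / (4 * (π * m₀ / a / 2))) ^ (K + 1)) / 2
        + (∑' k : ℕ, Real.exp (-(2 * (a : ℝ) * digammaNode k)) * digammaNode k ^ (2 * R + 1))
            / |π * m₀ / a| ^ (2 * R + 2)) X := by
  unfold remCBox at hX
  split at hX
  · rename_i B T hB hT
    simp only [Option.some.injEq] at hX
    subst hX
    have hBm := MI.mem_divNat (mem_remBracketBox hS hP ha hm₀ ν K hbt hB) (n := 2) (by norm_num)
    have hω := mem_powB hS (mem_omega0Box hP a m₀) (2 * R + 2)
    have hTm := MI.mem_divPos hS hT hD hω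
    have hpos : 0 ≤ π * (m₀ : ℝ) / (a : ℝ) := by
      have : (0 : ℝ) < a := by exact_mod_cast ha
      positivity
    rw [abs_of_nonneg hpos]
    convert MI.mem_add hBm hTm using 1
    push_cast; ring
  · simp at hX

end CinfCoeff

end Summit.RiemannHypothesis.RiemannHypothesis.Theorems.WeilFormatC
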